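import Summits.ValiantsHypothesis.ValiantsHypothesis.Theses.FifoMatching

/-!
# Route FifoMatching — `Assembly` (stmt-ValiantsHypothesis-11622)

`NNNotVP → NNInVNP → ValiantsHypothesis` is the route's deciding theorem `closes`; candidate proof on
file since 2026-08-15, landed under Theorems (prover-only). Honest framing: bookkeeping only.
-/

set_option linter.dupNamespace false

namespace Summit.ValiantsHypothesis.ValiantsHypothesis.Theorems.FifoMatching

open Summit.ValiantsHypothesis.ValiantsHypothesis.Theses.FifoMatching

/-- **Item `Assembly` (stmt-ValiantsHypothesis-11622), PROVED** by `closes`. [folklore] -/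
theorem assembly_proof : Assembly :=
  fun h₁ h₂ => closes h₁ h₂

end Summit.ValiantsHypothesis.ValiantsHypothesis.Theorems.FifoMatching
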